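import Literature.Barriers.RiemannHypothesis.TuranPartialSumsBoxData
import Literature.Analysis.ValidatedNumerics.MultiPrecisionInterval
import HarnessLib

/-!
# Sections of `ζ` beyond `σ = 1`: the box checker (Platt–Trudgian 2016, §2.2–§2.3)

Barrier catalogue `Literature/Barriers/RiemannHypothesis/`, companion of `TuranPartialSumsBoxData.lean`.
This file defines the executable checker whose acceptance (one compiled evaluation per `N`,
`TuranPartialSumsAssemblyCert.lean`) proves `BoxCert.Claim N` for `N ∈ {10, …, 18, 20, 21, 28}` and
hence discharges `PlattTrudgian2016_noZeros_sigma_ge_one`; the soundness theorem is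
`TuranPartialSumsBoxCertSound.lean`. Here: the checker, and the validity of its tables.

## The check (all integer arithmetic at scale `S = 2^28`)

A *box* is `σ ∈ 1 + [j, j+1]/2^l` times `θ_p ∈ 2π[a_p, a_p+1]/2^{L_p}` (`p = 2, 3, 5`). For a box and
a cofactor group `q`, with `n = 2^a 3^b 5^c` running over the group, `ρ_n = n^{-σ}`,
`φ_n = aθ₂ + bθ₃ + cθ₅`, centre angles `θ⁰_p` and `δθ_p = θ_p − θ⁰_p`:
`S² G_q = U_q + Σ_p δθ_p V_{q,p} + E_q`, `U_q = Σ_n rc_n C_n`, `V_{q,p} = i Σ_n α_{n,p} rc_n C_n`,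
`|E_q| ≤ R2_q` (second order: `|e^{iδ} − 1 − iδ| ≤ δ²` for `|δ| ≤ 1`, plus the `σ`-width and table
errors), where `C_n ∈ ℤ[i]` is the table value of `S e^{iφ⁰_n}` (binary angles, `2^14` per turn) and
`rc_n ± dr_n ∋ S ρ_n`. Then `S²|G_1| ≥ |U_1| + Σ_p δθ_p Re(Ū_1 V_{1,p})/|U_1| − R2_1` and
`S²|G_q| ≤ |U_q| + Σ_p δθ_p Re(Ū_q V_{q,p})/|U_q| + |Σ_p δθ_p V_{q,p}|²/(2|U_q|) + R2_q`; the SIGNED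
linear terms are combined over the groups (so that the vanishing of `∇F` at the minimiser is
exploited) and bounded by `Σ_p h_p |c_p|`. A box is accepted iff the resulting integer lower bound
for `S⁴ (|G_1| − Σ_q q^{-σ}|G_q|)` is positive; otherwise it is bisected (adaptively, `σ` or one
angle; magnitudes of the `σ`-children by integer square roots of products — the geometric mean —
starting from the exact `S/n`, `S/n²` at `σ = 1, 2`). `checkCells N lo n` runs the search on the
cells `lo, …, lo+n−1` of the initial grid (`σ` level 3; `θ₂ ∈ [0, π]` level 3; `θ₃, θ₅` level 2).

## Main definitions (namespace `Literature.Barriers.RiemannHypothesis.BoxCert`)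

* `Ctx`, `mkCtx`, `Ctx.Valid`, `mkCtx_valid` — `⌈πS⌉` and the table `C[m] ≈ S e^{2πi m/2^14}`
  (`|S e^{2πi m/2^14} − C[m]| ≤ epsT`, built from the tree's verified `NumericsMP.pi`/`expI`).
* `magRoot`, `magLeft`, `magRight`, `MagValid` — enclosures of `S n^{-σ}` (`n ≤ 28`) at the two ends
  of a `σ`-interval, and their validity.
* `compileGroups`, `evalBox`, `search`, `checkCell`, `checkCells`, `numCells`.

## References

* [PlattTrudgian2016] D. J. Platt, T. S. Trudgian, *Zeroes of partial sums of the zeta-function*,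
  LMS J. Comput. Math. 19 (2016), 37–41, §2.2–§2.3.
* R. E. Moore, *Interval Analysis* (1966), Ch. 3–4 (inclusion isotonicity, bisection). [folklore]
-/

open Complex
open Literature.Analysis.ValidatedNumerics.NumericsMP
open Literature.Analysis.ValidatedNumerics (Numerics.cdiv Numerics.div_le_cdiv Numerics.fdiv_le_div
  Numerics.le_cdiv_mul_real)

namespace Literature.Barriers.RiemannHypothesis

namespace BoxCert

/-! ## Parameters -/

/-- The scale `S = 2^28`. [folklore] -/
def S0 : ℕ := 268435456

/-- Angle resolution: the unit is `2π/2^M`, `M = 14`. [folklore] -/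
def M : ℕ := 14

/-- Guard scale `S · 2^24` for the transcendental tables. [folklore] -/
def SG : ℕ := 268435456 * 16777216

/-- Deepest `σ` level the search will use (heuristic only). [folklore] -/
def LSMAX : ℕ := 16

/-- Recursion fuel of the search. [folklore] -/
def FUEL : ℕ := 48

/-- Initial grid: `σ` level. [folklore] -/
def ls0 : ℕ := 3

/-- Initial grid: `θ₂` level (cells `a₂ < 4` cover `[0, π]`). [folklore] -/
def L02 : ℕ := 3

/-- Initial grid: `θ₃` level. [folklore] -/
def L03 : ℕ := 2

/-- Initial grid: `θ₅` level (when `5` is a core prime). [folklore] -/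
def L05 : ℕ := 2

/-! ## Tables -/

/-- The context of a run: `piS ≥ πS`, the table `cosT[m] ≈ S e^{2πi m/2^M}` and its error bound.
[folklore] -/
structure Ctx where
  /-- an integer `≥ π S` -/
  piS : ℤ
  /-- centres `(x, y)` with `|S e^{2πi m/2^M} − (x + iy)| ≤ epsT` -/
  cosT : Array (ℤ × ℤ)
  /-- the table error bound -/
  epsT : ℤ

/-- An enclosure of `2π · num / den` from one of `π`. [folklore] -/
def angleMI (piI : MI) (num den : ℕ) : MI := (piI.mulInt (2 * (num : ℤ))).divNat den

/-- The boxes `∋ e^{2πi j/den}`, `j < k`, at the guard scale. [folklore] -/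
def expTab (piI : MI) (den : ℕ) : ℕ → Option (Array MC)
  | 0 => some #[]
  | k + 1 =>
    match expTab piI den k, MC.expI SG 18 3 piI (angleMI piI k den) with
    | some A, some B => some (A.push B)
    | _, _ => none

/-- Centre and error of the table entry `m = 128 i + j`: the product box
`B2[i] · B1[j] ∋ e^{2πi m/2^M}` rescaled to `S`. [folklore] -/
def cosEntry (B1 B2 : Array MC) (m : ℕ) : (ℤ × ℤ) × ℤ :=
  let b := MC.mul SG (B2.getD (m / 128) default) (B1.getD (m % 128) default)
  let re := MI.rescale SG S0 b.re
  let im := MI.rescale SG S0 b.im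
  let cx := (re.lo + re.hi) / 2
  let cy := (im.lo + im.hi) / 2
  ((cx, cy), max (re.hi - cx) (cx - re.lo) + max (im.hi - cy) (cy - im.lo))

/-- Tail-recursive table builder: append the `k` entries `m, …, m+k−1`, tracking the maximal error.
[folklore] -/
def cosTabAux (B1 B2 : Array MC) : ℕ → ℕ → Array (ℤ × ℤ) → ℤ → Array (ℤ × ℤ) × ℤ
  | 0, _, A, e => (A, e)
  | k + 1, m, A, e =>
    let c := cosEntry B1 B2 m
    cosTabAux B1 B2 k (m + 1) (A.push c.1) (max e c.2)

/-- Build the context (`none` on failure of an enclosure). [folklore] -/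
def mkCtx : Option Ctx :=
  match MI.pi SG 14 with
  | none => none
  | some piI =>
    match expTab piI 16384 128, expTab piI 128 128 with
    | some B1, some B2 =>
      let T := cosTabAux B1 B2 16384 0 #[] 0
      some ⟨Numerics.cdiv piI.hi 16777216, T.1, T.2⟩
    | _, _ => none

/-! ## Magnitudes `S · n^{-σ}` on a `σ`-interval -/

/-- Integer square root rounded up. [folklore] -/
def sqrtCeil (n : ℕ) : ℕ := let r := Nat.sqrt n; if r * r < n then r + 1 else r

/-- The root table (`σ ∈ [1, 2]`): entry `n` is `(⌊S/n⌋, ⌈S/n⌉, ⌊S/n²⌋, ⌈S/n²⌉)`, i.e.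
enclosures of `S n^{-σ}` at `σ = 1` and at `σ = 2`. [folklore] -/
def magRoot : Array (ℕ × ℕ × ℕ × ℕ) :=
  (Array.range 29).map fun n ↦
    if n = 0 then (0, 0, 0, 0)
    else (S0 / n, (S0 + n - 1) / n, S0 / (n * n), (S0 + n * n - 1) / (n * n))

/-- Table of the left `σ`-child (geometric means at the midpoint). [folklore] -/
def magLeft (mag : Array (ℕ × ℕ × ℕ × ℕ)) : Array (ℕ × ℕ × ℕ × ℕ) :=
  mag.map fun e ↦ (e.1, e.2.1, Nat.sqrt (e.1 * e.2.2.1), sqrtCeil (e.2.1 * e.2.2.2))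

/-- Table of the right `σ`-child. [folklore] -/
def magRight (mag : Array (ℕ × ℕ × ℕ × ℕ)) : Array (ℕ × ℕ × ℕ × ℕ) :=
  mag.map fun e ↦ (Nat.sqrt (e.1 * e.2.2.1), sqrtCeil (e.2.1 * e.2.2.2), e.2.2.1, e.2.2.2)

/-- One bisection step: the right (`b = true`) or left child. [folklore] -/
def magStep (b : Bool) (mag : Array (ℕ × ℕ × ℕ × ℕ)) : Array (ℕ × ℕ × ℕ × ℕ) :=
  if b then magRight mag else magLeft mag

/-- Table of the `σ`-cell `js < 8` of the initial grid (three bisections of the root along the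
binary digits of `js`). [folklore] -/
def magCell (js : ℕ) : Array (ℕ × ℕ × ℕ × ℕ) :=
  magStep (decide (js % 2 = 1))
    (magStep (decide (js / 2 % 2 = 1)) (magStep (decide (js / 4 % 2 = 1)) magRoot))

/-! ## Box evaluation -/

/-- A term compiled against the magnitude table of a `σ`-box: exponents and `rc ± dr ∋ S ρ`,
`S ρ ≤ rhi`. [folklore] -/
structure CTerm where
  /-- exponent of `2` -/
  a : ℕ
  /-- exponent of `3` -/
  b : ℕ
  /-- exponent of `5` -/
  c : ℕ
  /-- centre magnitude -/
  rc : ℤ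
  /-- upper magnitude -/
  rhi : ℤ
  /-- magnitude radius -/
  dr : ℤ
  deriving Inhabited

/-- Compile a term. [folklore] -/
def compileTerm (mag : Array (ℕ × ℕ × ℕ × ℕ)) (t : Term) : CTerm :=
  let r := mag.getD t.smooth default
  let rlo : ℤ := (r.2.2.1 : ℤ)
  let rhi : ℤ := (r.2.1 : ℤ)
  let rc := (rlo + rhi) / 2
  ⟨t.a, t.b, t.c, rc, rhi, max (rhi - rc) (rc - rlo)⟩

/-- Compile the groups: weight `≥ S q^{-σ}` and compiled terms. [folklore] -/
def compileGroups (mag : Array (ℕ × ℕ × ℕ × ℕ)) (grps : List (ℕ × List Term)) :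
    List (ℤ × List CTerm) :=
  grps.map fun g ↦ (((mag.getD g.1 default).2.1 : ℤ), g.2.map (compileTerm mag))

/-- Group accumulator: `U`, `V₂, V₃, V₅` (Gaussian integers), `Σ rc H²`, `Σ dr`, `Σ rhi`, split
heuristics, and the flag "all `H_n ≤ S`". [folklore] -/
structure GAcc where
  /-- `Re U` -/
  ux : ℤ
  /-- `Im U` -/
  uy : ℤ
  /-- `Re V₂` -/
  v2x : ℤ
  /-- `Im V₂` -/
  v2y : ℤ
  /-- `Re V₃` -/
  v3x : ℤ
  /-- `Im V₃` -/
  v3y : ℤ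
  /-- `Re V₅` -/
  v5x : ℤ
  /-- `Im V₅` -/
  v5y : ℤ
  /-- `Σ rc · H²` -/
  t : ℤ
  /-- `Σ dr` -/
  dr : ℤ
  /-- `Σ rhi` -/
  rh : ℤ
  /-- heuristic share of `θ₂` -/
  sh2 : ℤ
  /-- heuristic share of `θ₃` -/
  sh3 : ℤ
  /-- heuristic share of `θ₅` -/
  sh5 : ℤ
  /-- all phase half-widths `≤ 1` -/
  ok : Bool

/-- The empty accumulator. [folklore] -/
def GAcc.zero : GAcc := ⟨0, 0, 0, 0, 0, 0, 0, 0, 0, 0, 0, 0, 0, 0, true⟩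

/-- Accumulate one term: table index `m` of the centre phase, scaled half-width `H_n`. [folklore] -/
def accTerm (c : Ctx) (m2 m3 m5 h2 h3 h5 : ℕ) (g : GAcc) (t : CTerm) : GAcc :=
  let m := (t.a * m2 + t.b * m3 + t.c * m5) % 16384
  let Hn : ℕ := t.a * h2 + t.b * h3 + t.c * h5
  let e := c.cosT.getD m default
  let tx := t.rc * e.1
  let ty := t.rc * e.2
  let H : ℤ := (Hn : ℤ)
  ⟨g.ux + tx, g.uy + ty,
    g.v2x - t.a * ty, g.v2y + t.a * tx, g.v3x - t.b * ty, g.v3y + t.b * tx,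
    g.v5x - t.c * ty, g.v5y + t.c * tx,
    g.t + t.rc * (H * H), g.dr + t.dr, g.rh + t.rhi,
    g.sh2 + t.rc * t.a * h2 * H, g.sh3 + t.rc * t.b * h3 * H, g.sh5 + t.rc * t.c * h5 * H,
    g.ok && decide (Hn ≤ 268435456)⟩

/-- Accumulate a list of terms. [folklore] -/
def accTerms (c : Ctx) (m2 m3 m5 h2 h3 h5 : ℕ) : List CTerm → GAcc → GAcc
  | [], g => g
  | t :: ts, g => accTerms c m2 m3 m5 h2 h3 h5 ts (accTerm c m2 m3 m5 h2 h3 h5 g t)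

/-- Summary of a group: `sm ≤ |U| ≤ sp`, `A_p = Re(Ū V_p)`, `W_p ≥ |V_p|`, the second-order
radius `R2`, the `σ`-share `drS`, heuristics, flag. [folklore] -/
structure GSum where
  /-- `⌊|U|⌋` -/
  sm : ℕ
  /-- `⌈|U|⌉` -/
  sp : ℕ
  /-- `Re(Ū V₂)` -/
  A2 : ℤ
  /-- `Re(Ū V₃)` -/
  A3 : ℤ
  /-- `Re(Ū V₅)` -/
  A5 : ℤ
  /-- `≥ |V₂|` -/
  W2 : ℕ
  /-- `≥ |V₃|` -/
  W3 : ℕ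
  /-- `≥ |V₅|` -/
  W5 : ℕ
  /-- second-order radius -/
  R2 : ℤ
  /-- `Σ dr · (S + epsT)` -/
  drS : ℤ
  /-- heuristic share of `θ₂` -/
  sh2 : ℤ
  /-- heuristic share of `θ₃` -/
  sh3 : ℤ
  /-- heuristic share of `θ₅` -/
  sh5 : ℤ
  /-- all phase half-widths `≤ 1` -/
  ok : Bool

/-- Ceiling division (the tree's `Numerics.cdiv`). [folklore] -/
def cdivZ (a b : ℤ) : ℤ := Numerics.cdiv a b

/-- Summarize an accumulator. [folklore] -/
def summarize (c : Ctx) (g : GAcc) : GSum :=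
  let n : ℕ := (g.ux * g.ux + g.uy * g.uy).toNat
  let sm := Nat.sqrt n
  let drS := g.dr * (268435456 + c.epsT)
  ⟨sm, sqrtCeil n,
    g.ux * g.v2x + g.uy * g.v2y, g.ux * g.v3x + g.uy * g.v3y, g.ux * g.v5x + g.uy * g.v5y,
    sqrtCeil (g.v2x * g.v2x + g.v2y * g.v2y).toNat, sqrtCeil (g.v3x * g.v3x + g.v3y * g.v3y).toNat,
    sqrtCeil (g.v5x * g.v5x + g.v5y * g.v5y).toNat,
    drS + g.rh * c.epsT + cdivZ (g.t * (268435456 + c.epsT)) (268435456 * 268435456),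
    drS, g.sh2, g.sh3, g.sh5, g.ok⟩

/-- The summary of a group of compiled terms on a box. [folklore] -/
def groupSum (c : Ctx) (m2 m3 m5 h2 h3 h5 : ℕ) (ts : List CTerm) : GSum :=
  summarize c (accTerms c m2 m3 m5 h2 h3 h5 ts GAcc.zero)

/-- A lower bound of `A / u` for `sm ≤ u ≤ sp`. [folklore] -/
def loQ (A : ℤ) (sm sp : ℕ) : ℤ := if 0 ≤ A then A / (sp : ℤ) else A / (sm : ℤ)

/-- An upper bound of `A / u` for `sm ≤ u ≤ sp`. [folklore] -/
def hiQ (A : ℤ) (sm sp : ℕ) : ℤ := if 0 ≤ A then cdivZ A sm else cdivZ A sp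

/-- Running state over the non-unit groups: the constant lower bound `total`, the enclosures
`[clo_p, chi_p]` of the signed linear coefficients, split penalties, flag. [folklore] -/
structure EState where
  /-- constant part, scale `S⁴` -/
  total : ℤ
  /-- lower bound of the `θ₂`-coefficient -/
  clo2 : ℤ
  /-- upper bound of the `θ₂`-coefficient -/
  chi2 : ℤ
  /-- lower bound of the `θ₃`-coefficient -/
  clo3 : ℤ
  /-- upper bound of the `θ₃`-coefficient -/
  chi3 : ℤ
  /-- lower bound of the `θ₅`-coefficient -/
  clo5 : ℤ
  /-- upper bound of the `θ₅`-coefficient -/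
  chi5 : ℤ
  /-- `σ` penalty (heuristic) -/
  penS : ℤ
  /-- `θ₂` penalty (heuristic) -/
  pen2 : ℤ
  /-- `θ₃` penalty (heuristic) -/
  pen3 : ℤ
  /-- `θ₅` penalty (heuristic) -/
  pen5 : ℤ
  /-- flag -/
  ok : Bool

/-- Process one non-unit group of weight `w ≥ S q^{-σ}`. [folklore] -/
def stepGroup (h2 h3 h5 : ℕ) (w : ℤ) (s : GSum) (e : EState) : EState :=
  let LM : ℤ := (h2 : ℤ) * s.W2 + (h3 : ℤ) * s.W3 + (h5 : ℤ) * s.W5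
  if s.sm = 0 then
    let UB := cdivZ LM 268435456 + s.R2
    ⟨e.total - 268435456 * w * UB, e.clo2, e.chi2, e.clo3, e.chi3, e.clo5, e.chi5,
      e.penS + 268435456 * w * s.drS, e.pen2 + w * s.sh2, e.pen3 + w * s.sh3, e.pen5 + w * s.sh5,
      e.ok && s.ok⟩
  else
    let UB := (s.sp : ℤ) + cdivZ (LM * LM) (2 * 268435456 * 268435456 * s.sm) + s.R2
    ⟨e.total - 268435456 * w * UB,
      e.clo2 - w * hiQ s.A2 s.sm s.sp, e.chi2 - w * loQ s.A2 s.sm s.sp,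
      e.clo3 - w * hiQ s.A3 s.sm s.sp, e.chi3 - w * loQ s.A3 s.sm s.sp,
      e.clo5 - w * hiQ s.A5 s.sm s.sp, e.chi5 - w * loQ s.A5 s.sm s.sp,
      e.penS + 268435456 * w * s.drS, e.pen2 + w * s.sh2, e.pen3 + w * s.sh3, e.pen5 + w * s.sh5,
      e.ok && s.ok⟩

/-- Process the non-unit groups. [folklore] -/
def stepGroups (c : Ctx) (m2 m3 m5 h2 h3 h5 : ℕ) : List (ℤ × List CTerm) → EState → EState
  | [], e => e
  | g :: gs, e =>
    stepGroups c m2 m3 m5 h2 h3 h5 gs (stepGroup h2 h3 h5 g.1 (groupSum c m2 m3 m5 h2 h3 h5 g.2) e)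

/-- `hOf c L ≥ π S / 2^L`: the scaled angular half-width at level `L`. [folklore] -/
def hOf (c : Ctx) (L : ℕ) : ℕ := (Numerics.cdiv c.piS (2 ^ L)).toNat

/-- Table index of the centre angle `π(2a+1)/2^L = 2π · midOf L a / 2^M` (`L ≤ M − 1`).
[folklore] -/
def midOf (L a : ℕ) : ℕ := (2 * a + 1) <<< (M - 1 - L)

/-- `|a|` as an integer. [folklore] -/
def zabs (a : ℤ) : ℤ := (a.natAbs : ℤ)

/-- The initial state of the fold, from the summary of the unit group. [folklore] -/
def e0Of (s : GSum) : EState :=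
  ⟨268435456 * (268435456 * ((s.sm : ℤ) - s.R2)),
    268435456 * loQ s.A2 s.sm s.sp, 268435456 * hiQ s.A2 s.sm s.sp,
    268435456 * loQ s.A3 s.sm s.sp, 268435456 * hiQ s.A3 s.sm s.sp,
    268435456 * loQ s.A5 s.sm s.sp, 268435456 * hiQ s.A5 s.sm s.sp,
    268435456 * 268435456 * s.drS, 268435456 * s.sh2, 268435456 * s.sh3, 268435456 * s.sh5, s.ok⟩

/-- The bound `Σ_p h_p max(|clo_p|, |chi_p|)` of the linear terms. [folklore] -/
def linOf (h2 h3 h5 : ℕ) (e : EState) : ℤ :=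
  (h2 : ℤ) * max (zabs e.clo2) (zabs e.chi2) + (h3 : ℤ) * max (zabs e.clo3) (zabs e.chi3) +
    (h5 : ℤ) * max (zabs e.clo5) (zabs e.chi5)

/-- The verdict: flag set and `lin < total`. [folklore] -/
def passOf (h2 h3 h5 : ℕ) (e : EState) : Bool := e.ok && decide (linOf h2 h3 h5 e < e.total)

/-- The suggested split axis (heuristic): `0 = σ`, `1, 2, 3 = θ₂, θ₃, θ₅`, `4` = coarse box.
[folklore] -/
def axisOf (h2 h3 h5 : ℕ) (e : EState) : ℕ :=
  let p2 := (h2 : ℤ) * max (zabs e.clo2) (zabs e.chi2) + e.pen2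
  let p3 := (h3 : ℤ) * max (zabs e.clo3) (zabs e.chi3) + e.pen3
  let p5 := (h5 : ℤ) * max (zabs e.clo5) (zabs e.chi5) + e.pen5
  let ax : ℕ × ℤ := (0, e.penS)
  let ax := if ax.2 < p2 then (1, p2) else ax
  let ax := if ax.2 < p3 then (2, p3) else ax
  let ax := if ax.2 < p5 then (3, p5) else ax
  if e.ok then ax.1 else 4

/-- **Box evaluation**: verdict and suggested split axis. [cite: PlattTrudgian2016, §2.2] -/
def evalBox (c : Ctx) (cg : List (ℤ × List CTerm)) (L2 L3 L5 a2 a3 a5 : ℕ) : Bool × ℕ :=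
  match cg with
  | [] => (false, 0)
  | g :: gs =>
    let s := groupSum c (midOf L2 a2) (midOf L3 a3) (midOf L5 a5) (hOf c L2) (hOf c L3) (hOf c L5) g.2
    if s.sm = 0 then (false, 1) else
    let e := stepGroups c (midOf L2 a2) (midOf L3 a3) (midOf L5 a5) (hOf c L2) (hOf c L3)
      (hOf c L5) gs (e0Of s)
    (passOf (hOf c L2) (hOf c L3) (hOf c L5) e, axisOf (hOf c L2) (hOf c L3) (hOf c L5) e)

/-! ## The search -/

/-- The axis to split (heuristic): the suggestion if allowed, else the first allowed; for a coarse
box (`sug = 4`) the widest allowed angle; `none` if stuck. [folklore] -/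
def chooseAxis (core5 : Bool) (sug ls L2 L3 L5 : ℕ) : Option ℕ :=
  let okS := decide (ls < LSMAX)
  let ok2 := decide (L2 + 1 < M)
  let ok3 := decide (L3 + 1 < M)
  let ok5 := core5 && decide (L5 + 1 < M)
  if sug = 0 ∧ okS then some 0
  else if sug = 1 ∧ ok2 then some 1
  else if sug = 2 ∧ ok3 then some 2
  else if sug = 3 ∧ ok5 then some 3
  else if sug = 4 then
    let s1 := if ok2 then 4 <<< (20 - L2) else 0
    let s2 := if ok3 then 2 <<< (20 - L3) else 0
    let s3 := if ok5 then 1 <<< (20 - L5) else 0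
    let b : ℕ × ℕ := (1, s1)
    let b := if b.2 < s2 then (2, s2) else b
    let b := if b.2 < s3 then (3, s3) else b
    if b.2 = 0 then none else some b.1
  else if okS then some 0
  else if ok2 then some 1
  else if ok3 then some 2
  else if ok5 then some 3
  else none

/-- **The search**: accept the box, or bisect it along the chosen axis (with fuel); angle levels
stay `≤ M − 1` (re-checked at each split). [cite: PlattTrudgian2016, §2.2] -/
def search (c : Ctx) (grps : List (ℕ × List Term)) (core5 : Bool) :
    ℕ → ℕ → Array (ℕ × ℕ × ℕ × ℕ) → List (ℤ × List CTerm) → ℕ → ℕ → ℕ → ℕ → ℕ → ℕ → Bool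
  | 0, _, _, cg, L2, L3, L5, a2, a3, a5 => (evalBox c cg L2 L3 L5 a2 a3 a5).1
  | fuel + 1, ls, mag, cg, L2, L3, L5, a2, a3, a5 =>
    let r := evalBox c cg L2 L3 L5 a2 a3 a5
    r.1 ||
      match chooseAxis core5 r.2 ls L2 L3 L5 with
      | none => false
      | some 0 =>
        (let magl := magLeft mag
         search c grps core5 fuel (ls + 1) magl (compileGroups magl grps) L2 L3 L5 a2 a3 a5) &&
        (let magr := magRight mag
         search c grps core5 fuel (ls + 1) magr (compileGroups magr grps) L2 L3 L5 a2 a3 a5)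
      | some 1 =>
        decide (L2 + 1 < M) &&
          (search c grps core5 fuel ls mag cg (L2 + 1) L3 L5 (2 * a2) a3 a5 &&
            search c grps core5 fuel ls mag cg (L2 + 1) L3 L5 (2 * a2 + 1) a3 a5)
      | some 2 =>
        decide (L3 + 1 < M) &&
          (search c grps core5 fuel ls mag cg L2 (L3 + 1) L5 a2 (2 * a3) a5 &&
            search c grps core5 fuel ls mag cg L2 (L3 + 1) L5 a2 (2 * a3 + 1) a5)
      | some _ =>
        decide (L5 + 1 < M) &&
          (search c grps core5 fuel ls mag cg L2 L3 (L5 + 1) a2 a3 (2 * a5) &&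
            search c grps core5 fuel ls mag cg L2 L3 (L5 + 1) a2 a3 (2 * a5 + 1))

/-! ## Cells and chunks -/

/-- The groups `(q, terms with cofactor q)`, `q ∈ qs N` (head `q = 1`). [folklore] -/
def groupsOf (N : ℕ) : List (ℕ × List Term) :=
  (qs N).map fun q ↦ (q, (terms N).filter fun t ↦ t.q = q)

/-- Number of `θ₅`-cells. [folklore] -/
def n5 (N : ℕ) : ℕ := if core5 N then 2 ^ L05 else 1

/-- Number of cells of the initial grid. [folklore] -/
def numCells (N : ℕ) : ℕ := 2 ^ ls0 * (2 ^ (L02 - 1) * (2 ^ L03 * n5 N))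

/-- Mixed-radix decoding of a cell index: `(js, a₂, a₃, a₅)`. [folklore] -/
def decodeCell (N idx : ℕ) : ℕ × ℕ × ℕ × ℕ :=
  (idx / n5 N / 2 ^ L03 / 2 ^ (L02 - 1), idx / n5 N / 2 ^ L03 % 2 ^ (L02 - 1),
    idx / n5 N % 2 ^ L03, idx % n5 N)

/-- Check one cell of the initial grid. [folklore] -/
def checkCell (c : Ctx) (N idx : ℕ) : Bool :=
  let d := decodeCell N idx
  let mag := magCell d.1
  let grps := groupsOf N
  search c grps (core5 N) FUEL ls0 mag (compileGroups mag grps) L02 L03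
    (if core5 N then L05 else 0) d.2.1 d.2.2.1 d.2.2.2

/-- **The chunk check**: build the context and check the cells `lo, …, lo + n − 1`.
[cite: PlattTrudgian2016, §2.3] -/
def checkCells (N lo n : ℕ) : Bool :=
  match mkCtx with
  | none => false
  | some c => (List.range' lo n).all (checkCell c N)

/-! ## Validity of the context -/

/-- The scales are positive. [folklore] -/
theorem SG_pos : 0 < SG := by decide

/-- [folklore] -/
theorem S0_pos : 0 < S0 := by decide

/-- `SG = S · 2^24`. [folklore] -/
theorem SG_eq : (SG : ℝ) = S0 * 16777216 := by norm_num [SG, S0]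

/-- `2π num/den ∈ angleMI`. [folklore] -/
theorem mem_angleMI {piI : MI} (hpi : MI.mem SG Real.pi piI) (num : ℕ) {den : ℕ} (hden : 0 < den) :
    MI.mem SG (2 * Real.pi * num / den) (angleMI piI num den) := by
  have := MI.mem_divNat (MI.mem_mulInt hpi (2 * (num : ℤ))) hden
  unfold angleMI
  convert this using 2
  push_cast
  ring

/-- Soundness of `expTab`. [folklore] -/
theorem expTab_spec {piI : MI} (hpi : MI.mem SG Real.pi piI) {den : ℕ} (hden : 0 < den) :
    ∀ (k : ℕ) {A : Array MC}, expTab piI den k = some A →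
      A.size = k ∧ ∀ j : ℕ, j < k →
        MC.mem SG (cexp (↑(2 * Real.pi * j / den) * I)) (A.getD j default)
  | 0, A, h => by
    simp only [expTab, Option.some.injEq] at h
    subst h
    exact ⟨rfl, fun j hj ↦ absurd hj (Nat.not_lt_zero _)⟩
  | k + 1, A, h => by
    simp only [expTab] at h
    split at h
    · rename_i A0 B hA0 hB
      simp only [Option.some.injEq] at h
      subst h
      obtain ⟨hsz, hmem⟩ := expTab_spec hpi hden k hA0
      refine ⟨by simp [hsz], fun j hj ↦ ?_⟩
      rcases Nat.lt_succ_iff_lt_or_eq.1 hj with hlt | rfl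
      · have hlt' : j < A0.size := by rw [hsz]; exact hlt
        have := hmem j hlt
        rw [Array.getD_eq_getD_getElem?, Array.getElem?_push_lt hlt', Option.getD_some]
        rwa [Array.getD_eq_getD_getElem?, getElem?_pos A0 j hlt', Option.getD_some] at this
      · have hidx : (A0.push B)[j]? = some B := by rw [← hsz]; exact Array.getElem?_push_size
        rw [Array.getD_eq_getD_getElem?, hidx, Option.getD_some]
        exact MC.mem_expI SG_pos hpi hB (mem_angleMI hpi j hden)
    · simp at h

/-- From `lo ≤ vS ≤ hi`: `|vS − c| ≤ max (hi − c) (c − lo)` for any integer `c`. [folklore] -/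
theorem abs_sub_le_of_mem {S : ℕ} {v : ℝ} {I : MI} (h : MI.mem S v I) (c : ℤ) :
    |v * S - c| ≤ (max (I.hi - c) (c - I.lo) : ℤ) := by
  obtain ⟨h1, h2⟩ := h
  rw [abs_le]
  push_cast
  constructor
  · have : ((c : ℝ) - I.lo) ≤ max ((I.hi : ℝ) - c) (c - I.lo) := le_max_right _ _
    linarith
  · have : ((I.hi : ℝ) - c) ≤ max ((I.hi : ℝ) - c) (c - I.lo) := le_max_left _ _
    linarith

/-- Soundness of `cosEntry`: for `m < 2^M = 16384`, `|S e^{2πi m/2^M} − centre| ≤ error`.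
[folklore] -/
theorem cosEntry_spec {B1 B2 : Array MC}
    (h1 : ∀ j : ℕ, j < 128 →
      MC.mem SG (cexp (↑(2 * Real.pi * j / (16384 : ℕ)) * I)) (B1.getD j default))
    (h2 : ∀ i : ℕ, i < 128 →
      MC.mem SG (cexp (↑(2 * Real.pi * i / (128 : ℕ)) * I)) (B2.getD i default))
    {m : ℕ} (hm : m < 16384) :
    ‖(S0 : ℂ) * cexp (↑(2 * Real.pi * m / 16384) * I) -
        ((cosEntry B1 B2 m).1.1 + (cosEntry B1 B2 m).1.2 * I)‖ ≤ (cosEntry B1 B2 m).2 := by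
  have hi : m / 128 < 128 := by omega
  have hj : m % 128 < 128 := Nat.mod_lt _ (by norm_num)
  set z : ℂ := cexp (↑(2 * Real.pi * m / 16384) * I) with hz
  have hprod : z = cexp (↑(2 * Real.pi * (m / 128 : ℕ) / (128 : ℕ)) * I) *
      cexp (↑(2 * Real.pi * (m % 128 : ℕ) / (16384 : ℕ)) * I) := by
    rw [hz, ← Complex.exp_add]
    congr 1
    have hm' : (m : ℂ) = 128 * ((m / 128 : ℕ) : ℂ) + ((m % 128 : ℕ) : ℂ) := by
      exact_mod_cast (Nat.div_add_mod m 128).symm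
    push_cast
    rw [hm']
    ring
  have hmem : MC.mem SG z (MC.mul SG (B2.getD (m / 128) default) (B1.getD (m % 128) default)) := by
    rw [hprod]
    exact MC.mem_mul SG_pos (h2 _ hi) (h1 _ hj)
  have hre := MI.mem_rescale SG_pos S0 hmem.1
  have him := MI.mem_rescale SG_pos S0 hmem.2
  simp only [cosEntry]
  set re := MI.rescale SG S0 (MC.mul SG (B2.getD (m / 128) default) (B1.getD (m % 128) default)).re
  set im := MI.rescale SG S0 (MC.mul SG (B2.getD (m / 128) default) (B1.getD (m % 128) default)).im
  set cx := (re.lo + re.hi) / 2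
  set cy := (im.lo + im.hi) / 2
  have e1 := abs_sub_le_of_mem hre cx
  have e2 := abs_sub_le_of_mem him cy
  push_cast at e1 e2
  have hw : (S0 : ℂ) * z - (↑cx + ↑cy * I) = ↑(z.re * S0 - cx) + ↑(z.im * S0 - cy) * I := by
    apply Complex.ext <;> simp <;> ring
  rw [hw]
  refine (norm_add_le _ _).trans ?_
  rw [norm_mul, Complex.norm_I, mul_one, Complex.norm_real, Complex.norm_real, Real.norm_eq_abs,
    Real.norm_eq_abs]
  push_cast
  linarith

/-- Soundness of `cosTabAux`. [folklore] -/
theorem cosTabAux_spec (B1 B2 : Array MC) :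
    ∀ (k m : ℕ) (A : Array (ℤ × ℤ)) (e : ℤ),
      (cosTabAux B1 B2 k m A e).1.size = A.size + k ∧ e ≤ (cosTabAux B1 B2 k m A e).2 ∧
      (∀ i : ℕ, i < A.size → (cosTabAux B1 B2 k m A e).1.getD i default = A.getD i default) ∧
      ∀ i : ℕ, i < k → (cosTabAux B1 B2 k m A e).1.getD (A.size + i) default = (cosEntry B1 B2 (m + i)).1 ∧
        (cosEntry B1 B2 (m + i)).2 ≤ (cosTabAux B1 B2 k m A e).2
  | 0, m, A, e => by
    simp [cosTabAux]
  | k + 1, m, A, e => by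
    simp only [cosTabAux]
    obtain ⟨hsz, hle, hold, hnew⟩ :=
      cosTabAux_spec B1 B2 k (m + 1) (A.push (cosEntry B1 B2 m).1) (max e (cosEntry B1 B2 m).2)
    refine ⟨by rw [hsz, Array.size_push]; ring, le_trans (le_max_left _ _) hle, fun i hi ↦ ?_,
      fun i hi ↦ ?_⟩
    · rw [hold i (by rw [Array.size_push]; omega), Array.getD_eq_getD_getElem?,
        Array.getElem?_push_lt hi, Array.getD_eq_getD_getElem?, getElem?_pos A i hi]
    · rcases Nat.eq_zero_or_pos i with rfl | hpos
      · refine ⟨?_, le_trans (le_max_right _ _) hle⟩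
        simp only [Nat.add_zero]
        rw [hold A.size (by rw [Array.size_push]; omega), Array.getD_eq_getD_getElem?,
          Array.getElem?_push_size, Option.getD_some]
      · obtain ⟨hget, herr⟩ := hnew (i - 1) (by omega)
        rw [Array.size_push, show A.size + 1 + (i - 1) = A.size + i by omega,
          show m + 1 + (i - 1) = m + i by omega] at hget
        rw [show m + 1 + (i - 1) = m + i by omega] at herr
        exact ⟨hget, herr⟩

/-- Validity of a context. [folklore] -/
structure Ctx.Valid (c : Ctx) : Prop where
  /-- `π S ≤ piS` -/
  piS : Real.pi * S0 ≤ c.piS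
  /-- the table bound (`2^M = 16384` entries) -/
  cos : ∀ m : ℕ, m < 16384 → ‖(S0 : ℂ) * cexp (↑(2 * Real.pi * m / 16384) * I) -
    ((c.cosT.getD m default).1 + (c.cosT.getD m default).2 * I)‖ ≤ c.epsT

/-- **The built context is valid.** [folklore] -/
theorem mkCtx_valid {c : Ctx} (h : mkCtx = some c) : c.Valid := by
  unfold mkCtx at h
  split at h
  · simp at h
  · rename_i piI hpi
    split at h
    · rename_i B1 B2 hB1 hB2
      simp only [Option.some.injEq] at h
      subst h
      have hpim := MI.mem_pi SG hpi
      obtain ⟨-, h1⟩ := expTab_spec hpim (den := 16384) (by decide) 128 hB1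
      obtain ⟨-, h2⟩ := expTab_spec hpim (den := 128) (by decide) 128 hB2
      constructor
      · -- `π S ≤ ⌈hi(π)/2^24⌉`
        have hhi := hpim.2
        have := Numerics.div_le_cdiv (a := piI.hi) (b := 16777216) (by norm_num)
        simp only
        rw [SG_eq] at hhi
        have h3 : Real.pi * S0 ≤ (piI.hi : ℝ) / 16777216 := by
          rw [le_div_iff₀ (by norm_num)]; linarith
        push_cast at this
        linarith
      · intro m hm
        obtain ⟨-, -, -, hnew⟩ := cosTabAux_spec B1 B2 16384 0 #[] 0
        obtain ⟨hget, herr⟩ := hnew m hm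
        have hsz0 : (#[] : Array (ℤ × ℤ)).size + m = m := by simp
        rw [hsz0, Nat.zero_add] at hget
        rw [Nat.zero_add] at herr
        simp only
        rw [hget]
        exact (cosEntry_spec h1 h2 hm).trans (by exact_mod_cast herr)
    · simp at h

/-! ## Validity of the magnitude tables -/

/-- `σ⁻ = 1 + js/2^ls`. [folklore] -/
noncomputable def sigLo (ls js : ℕ) : ℝ := 1 + (js : ℝ) / 2 ^ ls

/-- `σ⁺ = 1 + (js + 1)/2^ls`. [folklore] -/
noncomputable def sigHi (ls js : ℕ) : ℝ := 1 + ((js : ℝ) + 1) / 2 ^ ls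

/-- Left child: same lower end. [folklore] -/
theorem sigLo_left (ls js : ℕ) : sigLo (ls + 1) (2 * js) = sigLo ls js := by
  simp only [sigLo, pow_succ]; push_cast; ring

/-- Left child: upper end at the midpoint. [folklore] -/
theorem sigHi_left (ls js : ℕ) : sigHi (ls + 1) (2 * js) = (sigLo ls js + sigHi ls js) / 2 := by
  simp only [sigLo, sigHi, pow_succ]; push_cast; ring

/-- Right child: lower end at the midpoint. [folklore] -/
theorem sigLo_right (ls js : ℕ) : sigLo (ls + 1) (2 * js + 1) = (sigLo ls js + sigHi ls js) / 2 := by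
  simp only [sigLo, sigHi, pow_succ]; push_cast; ring

/-- Right child: same upper end. [folklore] -/
theorem sigHi_right (ls js : ℕ) : sigHi (ls + 1) (2 * js + 1) = sigHi ls js := by
  simp only [sigHi, pow_succ]; push_cast; ring

/-- Validity of a magnitude table on the `σ`-interval `[σ⁻, σ⁺]` of `(ls, js)`: entry
`n ∈ [1, 28]` is `(lo⁻, hi⁻, lo⁺, hi⁺)` with `lo∓ ≤ S n^{-σ∓} ≤ hi∓`. [folklore] -/
structure MagValid (ls js : ℕ) (mag : Array (ℕ × ℕ × ℕ × ℕ)) : Prop where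
  /-- size -/
  size : mag.size = 29
  /-- lower bound at `σ⁻` -/
  lo1 : ∀ n : ℕ, 1 ≤ n → n ≤ 28 → ((mag.getD n default).1 : ℝ) ≤ S0 * (n : ℝ) ^ (-sigLo ls js)
  /-- upper bound at `σ⁻` -/
  hi1 : ∀ n : ℕ, 1 ≤ n → n ≤ 28 → S0 * (n : ℝ) ^ (-sigLo ls js) ≤ ((mag.getD n default).2.1 : ℝ)
  /-- lower bound at `σ⁺` -/
  lo2 : ∀ n : ℕ, 1 ≤ n → n ≤ 28 →
    ((mag.getD n default).2.2.1 : ℝ) ≤ S0 * (n : ℝ) ^ (-sigHi ls js)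
  /-- upper bound at `σ⁺` -/
  hi2 : ∀ n : ℕ, 1 ≤ n → n ≤ 28 →
    S0 * (n : ℝ) ^ (-sigHi ls js) ≤ ((mag.getD n default).2.2.2 : ℝ)

/-- Entries of a mapped `Array.range`. [folklore] -/
theorem getD_map_range {β : Type*} [Inhabited β] (f : ℕ → β) {k n : ℕ} (hn : n < k) :
    ((Array.range k).map f).getD n default = f n := by
  rw [Array.getD_eq_getD_getElem?, Array.getElem?_map]
  simp [hn]

/-- Entries of a mapped array. [folklore] -/
theorem getD_map {α β : Type*} [Inhabited α] [Inhabited β] (A : Array α) (f : α → β) {n : ℕ}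
    (hn : n < A.size) : (A.map f).getD n default = f (A.getD n default) := by
  rw [Array.getD_eq_getD_getElem?, Array.getElem?_map, Array.getD_eq_getD_getElem?,
    getElem?_pos A n hn]
  rfl

/-- Ceiling division: `a ≤ ⌈a/n⌉ · n`. [folklore] -/
theorem le_ceilDiv_mul (a : ℕ) {n : ℕ} (hn : 0 < n) : a ≤ (a + n - 1) / n * n := by
  have := Nat.lt_div_mul_add (a := a + n - 1) hn
  omega

/-- `k ≤ ⌈√k⌉²`. [folklore] -/
theorem le_sqrtCeil_sq (k : ℕ) : k ≤ sqrtCeil k ^ 2 := by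
  unfold sqrtCeil
  simp only
  split_ifs with h
  · exact (Nat.lt_succ_sqrt' k).le
  · rw [sq]; omega

/-- **The root table is valid** (`σ ∈ [1, 2]`: `S n^{-1} = S/n`, `S n^{-2} = S/n²`). [folklore] -/
theorem magRoot_valid : MagValid 0 0 magRoot := by
  have hlo : -sigLo 0 0 = -1 := by norm_num [sigLo]
  have hhi : -sigHi 0 0 = -2 := by norm_num [sigHi]
  have hget : ∀ n : ℕ, 1 ≤ n → n ≤ 28 → magRoot.getD n default =
      (S0 / n, (S0 + n - 1) / n, S0 / (n * n), (S0 + n * n - 1) / (n * n)) := by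
    intro n h1 h2
    rw [magRoot, getD_map_range _ (by omega : n < 29), if_neg (by omega)]
  have hp1 : ∀ n : ℕ, 1 ≤ n → (n : ℝ) ^ (-(1 : ℝ)) = 1 / n := fun n _ ↦ by
    rw [Real.rpow_neg_one, one_div]
  have hp2 : ∀ n : ℕ, 1 ≤ n → (n : ℝ) ^ (-(2 : ℝ)) = 1 / ((n : ℝ) * n) := fun n hn ↦ by
    rw [Real.rpow_neg (by positivity), Real.rpow_two, sq, one_div]
  refine ⟨by simp [magRoot], fun n h1 h2 ↦ ?_, fun n h1 h2 ↦ ?_, fun n h1 h2 ↦ ?_, fun n h1 h2 ↦ ?_⟩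
  · rw [hget n h1 h2, hlo, hp1 n h1, mul_one_div]
    exact Nat.cast_div_le
  · rw [hget n h1 h2, hlo, hp1 n h1, mul_one_div]
    have hn : (0 : ℝ) < n := by exact_mod_cast h1
    rw [div_le_iff₀ hn]
    exact_mod_cast le_ceilDiv_mul S0 (by omega : 0 < n)
  · rw [hget n h1 h2, hhi, hp2 n h1, mul_one_div]
    have := Nat.cast_div_le (m := S0) (n := n * n) (α := ℝ)
    push_cast at this
    exact this
  · rw [hget n h1 h2, hhi, hp2 n h1, mul_one_div]
    have hn0 : (0 : ℝ) < n := by exact_mod_cast h1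
    have hn : (0 : ℝ) < n * n := mul_pos hn0 hn0
    rw [div_le_iff₀ hn]
    exact_mod_cast le_ceilDiv_mul S0 (by positivity : 0 < n * n)

/-- The midpoint identity: `S n^{-σm} = √(S n^{-σ⁻} · S n^{-σ⁺})`, `σm = (σ⁻ + σ⁺)/2`, as
`(S n^{-σm})² = …`. [folklore] -/
theorem sq_mag_mid {n : ℕ} (hn : 1 ≤ n) (a b : ℝ) :
    ((S0 : ℝ) * (n : ℝ) ^ (-((a + b) / 2))) ^ 2 = (S0 * (n : ℝ) ^ (-a)) * (S0 * (n : ℝ) ^ (-b)) := by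
  have hn' : (0 : ℝ) < n := by exact_mod_cast hn
  rw [mul_pow, sq ((n : ℝ) ^ _), ← Real.rpow_add hn',
    show (S0 : ℝ) * (n : ℝ) ^ (-a) * (S0 * (n : ℝ) ^ (-b)) =
      (S0 : ℝ) ^ 2 * ((n : ℝ) ^ (-a) * (n : ℝ) ^ (-b)) by ring,
    ← Real.rpow_add hn', show -((a + b) / 2) + -((a + b) / 2) = -a + -b by ring]

/-- From integer bounds of the endpoint values to bounds of the geometric mean. [folklore] -/
theorem sqrt_bounds {lo₁ hi₁ lo₂ hi₂ : ℕ} {X Y Z : ℝ} (hX : (lo₁ : ℝ) ≤ X) (hX' : X ≤ hi₁)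
    (hY : (lo₂ : ℝ) ≤ Y) (hY' : Y ≤ hi₂) (hZ : 0 ≤ Z) (hsq : Z ^ 2 = X * Y) :
    (Nat.sqrt (lo₁ * lo₂) : ℝ) ≤ Z ∧ Z ≤ (sqrtCeil (hi₁ * hi₂) : ℝ) := by
  have hlo : (0 : ℝ) ≤ lo₁ := Nat.cast_nonneg _
  have hlo' : (0 : ℝ) ≤ lo₂ := Nat.cast_nonneg _
  have hXY : (lo₁ : ℝ) * lo₂ ≤ X * Y := mul_le_mul hX hY hlo' (hlo.trans hX)
  have hXY' : X * Y ≤ (hi₁ : ℝ) * hi₂ :=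
    mul_le_mul hX' hY' (hlo'.trans hY) ((hlo.trans hX).trans hX')
  constructor
  · have h1 : ((Nat.sqrt (lo₁ * lo₂) : ℕ) : ℝ) ^ 2 ≤ Z ^ 2 := by
      rw [hsq]
      refine le_trans ?_ hXY
      exact_mod_cast Nat.sqrt_le' (lo₁ * lo₂)
    exact le_of_sq_le_sq h1 hZ  -- `abs_le_abs`-free: both sides nonneg
  · have h1 : Z ^ 2 ≤ ((sqrtCeil (hi₁ * hi₂) : ℕ) : ℝ) ^ 2 := by
      rw [hsq]
      refine hXY'.trans ?_
      exact_mod_cast le_sqrtCeil_sq (hi₁ * hi₂)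
    exact le_of_sq_le_sq h1 (Nat.cast_nonneg _)

/-- **The left child is valid.** [folklore] -/
theorem magLeft_valid {ls js : ℕ} {mag : Array (ℕ × ℕ × ℕ × ℕ)} (h : MagValid ls js mag) :
    MagValid (ls + 1) (2 * js) (magLeft mag) := by
  have hsL : sigLo (ls + 1) (2 * js) = sigLo ls js := by
    simp only [sigLo, pow_succ]; push_cast; ring
  have hsH : sigHi (ls + 1) (2 * js) = (sigLo ls js + sigHi ls js) / 2 := by
    simp only [sigLo, sigHi, pow_succ]; push_cast; ring
  have hget : ∀ n : ℕ, n ≤ 28 → (magLeft mag).getD n default =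
      ((mag.getD n default).1, (mag.getD n default).2.1,
        Nat.sqrt ((mag.getD n default).1 * (mag.getD n default).2.2.1),
        sqrtCeil ((mag.getD n default).2.1 * (mag.getD n default).2.2.2)) := fun n hn ↦ by
    rw [magLeft, getD_map _ _ (by rw [h.size]; omega)]
  refine ⟨by rw [magLeft, Array.size_map, h.size], fun n h1 h2 ↦ ?_, fun n h1 h2 ↦ ?_,
    fun n h1 h2 ↦ ?_, fun n h1 h2 ↦ ?_⟩
  · rw [hget n h2, hsL]; exact h.lo1 n h1 h2
  · rw [hget n h2, hsL]; exact h.hi1 n h1 h2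
  · rw [hget n h2, hsH]
    exact (sqrt_bounds (h.lo1 n h1 h2) (h.hi1 n h1 h2) (h.lo2 n h1 h2) (h.hi2 n h1 h2)
      (by positivity) (sq_mag_mid h1 _ _)).1
  · rw [hget n h2, hsH]
    exact (sqrt_bounds (h.lo1 n h1 h2) (h.hi1 n h1 h2) (h.lo2 n h1 h2) (h.hi2 n h1 h2)
      (by positivity) (sq_mag_mid h1 _ _)).2

/-- **The right child is valid.** [folklore] -/
theorem magRight_valid {ls js : ℕ} {mag : Array (ℕ × ℕ × ℕ × ℕ)} (h : MagValid ls js mag) :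
    MagValid (ls + 1) (2 * js + 1) (magRight mag) := by
  have hsL : sigLo (ls + 1) (2 * js + 1) = (sigLo ls js + sigHi ls js) / 2 := by
    simp only [sigLo, sigHi, pow_succ]; push_cast; ring
  have hsH : sigHi (ls + 1) (2 * js + 1) = sigHi ls js := by
    simp only [sigHi, pow_succ]; push_cast; ring
  have hget : ∀ n : ℕ, n ≤ 28 → (magRight mag).getD n default =
      (Nat.sqrt ((mag.getD n default).1 * (mag.getD n default).2.2.1),
        sqrtCeil ((mag.getD n default).2.1 * (mag.getD n default).2.2.2),
        (mag.getD n default).2.2.1, (mag.getD n default).2.2.2) := fun n hn ↦ by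
    rw [magRight, getD_map _ _ (by rw [h.size]; omega)]
  refine ⟨by rw [magRight, Array.size_map, h.size], fun n h1 h2 ↦ ?_, fun n h1 h2 ↦ ?_,
    fun n h1 h2 ↦ ?_, fun n h1 h2 ↦ ?_⟩
  · rw [hget n h2, hsL]
    exact (sqrt_bounds (h.lo1 n h1 h2) (h.hi1 n h1 h2) (h.lo2 n h1 h2) (h.hi2 n h1 h2)
      (by positivity) (sq_mag_mid h1 _ _)).1
  · rw [hget n h2, hsL]
    exact (sqrt_bounds (h.lo1 n h1 h2) (h.hi1 n h1 h2) (h.lo2 n h1 h2) (h.hi2 n h1 h2)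
      (by positivity) (sq_mag_mid h1 _ _)).2
  · rw [hget n h2, hsH]; exact h.lo2 n h1 h2
  · rw [hget n h2, hsH]; exact h.hi2 n h1 h2

/-- Validity of a bisection step. [folklore] -/
theorem magStep_valid (b : Bool) {ls js : ℕ} {mag : Array (ℕ × ℕ × ℕ × ℕ)} (h : MagValid ls js mag) :
    MagValid (ls + 1) (2 * js + b.toNat) (magStep b mag) := by
  cases b
  · simpa [magStep] using magLeft_valid h
  · simpa [magStep] using magRight_valid h

/-- **The cell tables are valid**: `magCell js` on `σ ∈ 1 + [js, js+1]/8`, `js < 8`. [folklore] -/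
theorem magCell_valid {js : ℕ} (hjs : js < 8) : MagValid 3 js (magCell js) := by
  have h3 := magStep_valid (decide (js % 2 = 1))
    (magStep_valid (decide (js / 2 % 2 = 1)) (magStep_valid (decide (js / 4 % 2 = 1)) magRoot_valid))
  unfold magCell
  convert h3 using 2
  interval_cases js <;> decide

end BoxCert

end Literature.Barriers.RiemannHypothesis
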